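import Literature.NumberTheory.LFunctions.ConreyIwaniec2002Prop64Holds
import Literature.NumberTheory.LFunctions.ConreyIwaniec2002Prop81LargeCloseOfProp64Holds
import Literature.NumberTheory.LFunctions.ConreyIwaniec2002Prop91LargeOfProp64
import Literature.NumberTheory.LFunctions.ConreyIwaniec2002Prop91AnyCompanions
import Literature.NumberTheory.LFunctions.ConreyIwaniec2002Prop91Unrestricted
import Literature.NumberTheory.LFunctions.ConreyIwaniec2002Prop81Unrestricted
import Literature.NumberTheory.LFunctions.ConreyIwaniec2002Prop91FarCompanions
import Literature.NumberTheory.LFunctions.ConreyIwaniec2002FloorClose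
import Literature.NumberTheory.LFunctions.ConreyIwaniec2002Prop91Floor
import HarnessLib

/-!
# Conrey–Iwaniec (2002): the odd-`q` chain §§8–10 made UNCONDITIONAL (Proposition 6.4 discharged)

B. Conrey, H. Iwaniec, *Spacing of zeros of Hecke L-functions and the class number problem*,
Acta Arith. 103 (2002) 259–312 [held text `paper:arxiv-math_0111012`], §§5–10.

Every door of the odd-`q` Conrey–Iwaniec chain was landed in the tree as a theorem
`…_of_proposition64 (h64 : conreyIwaniec2002_proposition64)` whose ONLY hypothesis is the typed
Proposition 6.4 (`ConreyIwaniec2002Prop81LargeCloseOfProp64Holds`, `ConreyIwaniec2002Prop91LargeOfProp64`,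
`ConreyIwaniec2002Prop91AnyCompanions`, `ConreyIwaniec2002Prop91Unrestricted`,
`ConreyIwaniec2002Prop81Unrestricted`, `ConreyIwaniec2002Prop91FarCompanions`,
`ConreyIwaniec2002FloorClose`, `ConreyIwaniec2002Prop91Floor`). Proposition 6.4 is now a kernel
theorem (`conreyIwaniec2002_proposition64_holds`, `ConreyIwaniec2002Prop64Holds`), so each door is
discharged here by one application. This file PROVES, with no hypothesis left:

* the named statements `conreyIwaniec2002_proposition81_large_close` (Proposition 8.1 (8.10) in the
  range of its printed proof), `conreyIwaniec2002_theorem11_weak` (Theorem 1.1, exponent `−(2A+7)`,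
  `q` odd) and `conreyIwaniec2002_corollary102` (Corollary 10.2: subnormal gaps between consecutive
  critical zeros of `ζ` give `L(1,χ) ≫ (log q)^{−90}`, `q` odd) — `…_holds`;
* Proposition 9.1 (9.7) in every landed range (`prop91_large` = the I6 skeleton's `stub_prop91_large`
  text, `prop91_close`, `prop91_floor_close`, `prop91_floor`, `prop91_unrestricted`, `prop91_far`,
  `prop91_any`) and Proposition 8.1 (8.10) with arbitrary companions (`prop81_unrestricted`,
  `prop81_floor_close`);
* the principal estimate (9.12) with `(log q)^{7/2}` (`proposition92_weak`, fact-free in (9.11)) and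
  in exponent-`e` form given the (9.11)-type input `h4` (`principalEstimate`);
* `L(1,χ) ≥ (log q)^{−67}` under the close-zero hypothesis of Theorem 1.1 (`lOne_ge_log_pow_neg_67`),
  Corollary 1.3 for odd `q` in weak form (`corollary13_odd_weak`), and the Dedekind-close-zero door
  with `H_K(A, α)` as its ONLY hypothesis (`lOne_lowerBound_of_dedekindCloseZero_weak`);
* Proposition 9.2 AS TYPED (`conreyIwaniec2002_proposition92`) modulo ONLY the printed cosmetic claim
  of (9.11) (`proposition92_of_Lq`; HONEST LABEL: `|L′(1,χ)| ≪ log q` in the exceptional regime —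
  OPEN, Friedlander–Iwaniec 2018; NOT proved and not claimed here).

NOT touched: the typed UNRESTRICTED `conreyIwaniec2002_proposition81` / `conreyIwaniec2002_proposition91`
(range "`T ≥ 2`"; false-suspect at small `T`), the printed `conreyIwaniec2002_theorem11` /
`conreyIwaniec2002_corollary13` / `conreyIwaniec2002_theorem12` (all `q`, printed exponents).
No definition; no summit statement. These are Conrey–Iwaniec's 2002 results for ODD `q` made
unconditional in the kernel — nothing about Landau–Siegel zeros beyond what CI 2002 prints.

«The programme SEARCHES and TYPES; no claim about Landau–Siegel zeros, Theorems 1–2 of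
arXiv:2211.02515 or a repaired Margin232 until a kernel theorem says so.»

## References
* [ConreyIwaniec2002] B. Conrey, H. Iwaniec, Acta Arith. 103 (2002) 259–312, arXiv:math/0111012:
  Proposition 6.4 (6.52), Proposition 8.1 (8.10), Proposition 9.1 (9.7), Proposition 9.2 (9.12),
  (9.11), Proposition 10.1, Corollary 10.2, Theorem 1.1 (1.21), Corollary 1.3.
* [FriedlanderIwaniec2018] J. Friedlander, H. Iwaniec, *A note on Dirichlet L-functions*, Expo.
  Math. 36 (2018) 343–350, arXiv:1701.03771 (status of the bound behind (9.11)).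
-/

noncomputable section

open scoped NumberField
open Complex

namespace Literature.NumberTheory.LFunctions

/-! ### Discharges of the three named statements of the odd-`q` chain -/

/-- **CI PROPOSITION 8.1 (`_large_close`) HOLDS** — discharge of the named statement
`conreyIwaniec2002_proposition81_large_close`: (8.10) for `1`-spaced `S ⊂ (T,2T]`, `q^66 ≤ T`,
`e^{(log q)²} ≤ T`, companions `|t′ − t| ≤ 1`, `q` odd, class-group `ψ`; from Proposition 6.4
(`conreyIwaniec2002_proposition64_holds`) by `conreyIwaniec2002_proposition81_large_close_of_proposition64`.
[cite: ConreyIwaniec2002, Proposition 8.1 (8.10)] -/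
theorem conreyIwaniec2002_proposition81_large_close_holds :
    conreyIwaniec2002_proposition81_large_close :=
  ConreyIwaniec2002.conreyIwaniec2002_proposition81_large_close_of_proposition64
    conreyIwaniec2002_proposition64_holds

/-- **CI THEOREM 1.1 (weak form, exponent `−(2A+7)`, `q` odd) HOLDS** — discharge of the named
statement `conreyIwaniec2002_theorem11_weak`, from Proposition 6.4 by `theorem11_weak_of_proposition64`.
[cite: ConreyIwaniec2002, Theorem 1.1 (1.21)] -/
theorem conreyIwaniec2002_theorem11_weak_holds : conreyIwaniec2002_theorem11_weak :=
  ConreyIwaniec2002.theorem11_weak_of_proposition64 conreyIwaniec2002_proposition64_holds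

/-- **CI COROLLARY 10.2 HOLDS** — discharge of the named statement `conreyIwaniec2002_corollary102`
("suppose `#{ρ ; 0 < γ ≤ T, |γ − γ′| ≤ (π/log γ)(1 − 1/√log γ)} ≫ T(log T)^{4/5}` for any
`T ≥ 2001`; then `L(1,χ) ≫ (log q)^{−90}`", `χ = (−q/·)`, `q` odd), from Proposition 6.4 by
`corollary102_of_proposition64`. [cite: ConreyIwaniec2002, Corollary 10.2] -/
theorem conreyIwaniec2002_corollary102_holds : conreyIwaniec2002_corollary102 :=
  ConreyIwaniec2002.corollary102_of_proposition64 conreyIwaniec2002_proposition64_holds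

namespace ConreyIwaniec2002

open NumberField

/-! ### Proposition 9.1 (9.7) and Proposition 8.1 (8.10), unconditional in every landed range -/

/-- **CI PROPOSITION 9.1 (9.7), printed range `q^65 ≤ T`, `e^{(log q)²} ≤ T`, ARBITRARY companions
`t′`, UNCONDITIONAL** — the statement of the I6 skeleton's `stub_prop91_large` verbatim
(`prop91_large_of_proposition64` at `proposition64_holds`). [cite: ConreyIwaniec2002, Proposition 9.1 (9.7)] -/
theorem prop91_large :
    ∃ C : ℝ, 0 < C ∧
    ∀ (q : ℕ) [NeZero q], 4 < q → Odd q → ∀ χ : DirichletCharacter ℂ q,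
      χ.IsPrimitive → χ.IsQuadratic → χ.Odd →
        ∀ (K : Type) [Field K] [NumberField K],
          Module.finrank ℚ K = 2 → NumberField.discr K = -(q : ℤ) →
            ∀ (ψ : ClassGroup (𝓞 K) →* ℂˣ) (T : ℝ) (S : Finset ℝ) (t' : ℝ → ℝ),
              (q : ℝ) ^ (65 : ℕ) ≤ T → Real.exp (Real.log q ^ (2 : ℕ)) ≤ T → IsDyadicPointSet S T →
                defectE K ψ q S t' ≤
                  C * (T * Real.log q ^ (6 : ℕ) +
                    T * Real.sqrt (calL χ T) * Real.log T ^ (2 : ℕ) * Real.log q ^ ((5 : ℝ) / 2)) :=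
  prop91_large_of_proposition64 proposition64_holds

/-- **CI PROPOSITION 9.1 (9.7), `q^66 ≤ T`, `e^{(log q)²} ≤ T`, companions `|t′(t) − t| ≤ 1`,
UNCONDITIONAL** (`prop91_close_of_proposition64` at `proposition64_holds`).
[cite: ConreyIwaniec2002, Proposition 9.1 (9.7)] -/
theorem prop91_close :
    ∃ C : ℝ, 0 < C ∧
    ∀ (q : ℕ) [NeZero q], 4 < q → Odd q → ∀ χ : DirichletCharacter ℂ q,
      χ.IsPrimitive → χ.IsQuadratic → χ.Odd →
        ∀ (K : Type) [Field K] [NumberField K],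
          Module.finrank ℚ K = 2 → NumberField.discr K = -(q : ℤ) →
            ∀ (ψ : ClassGroup (𝓞 K) →* ℂˣ) (T : ℝ) (S : Finset ℝ) (t' : ℝ → ℝ),
              (q : ℝ) ^ (66 : ℕ) ≤ T → Real.exp (Real.log q ^ (2 : ℕ)) ≤ T → IsDyadicPointSet S T →
                (∀ t ∈ S, |t' t - t| ≤ 1) →
                defectE K ψ q S t' ≤
                  C * (T * Real.log q ^ (6 : ℕ) +
                    T * Real.sqrt (calL χ T) * Real.log T ^ (2 : ℕ) * Real.log q ^ ((5 : ℝ) / 2)) :=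
  prop91_close_of_proposition64 proposition64_holds

/-- **CI PROPOSITION 9.1 (9.7) at the floor, close companions, UNCONDITIONAL**: `q^65 ≤ T`,
`e^{(log q)²} ≤ T`, points `t ≥ q^65 + q`, `|t′(t) − t| ≤ 1`
(`prop91_floor_close_of_proposition64` at `proposition64_holds`). [cite: ConreyIwaniec2002, Proposition 9.1 (9.7)] -/
theorem prop91_floor_close :
    ∃ C : ℝ, 0 < C ∧
    ∀ (q : ℕ) [NeZero q], 4 < q → Odd q → ∀ χ : DirichletCharacter ℂ q,
      χ.IsPrimitive → χ.IsQuadratic → χ.Odd →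
        ∀ (K : Type) [Field K] [NumberField K],
          Module.finrank ℚ K = 2 → NumberField.discr K = -(q : ℤ) →
            ∀ (ψ : ClassGroup (𝓞 K) →* ℂˣ) (T : ℝ) (S : Finset ℝ) (t' : ℝ → ℝ),
              (q : ℝ) ^ (65 : ℕ) ≤ T → Real.exp (Real.log q ^ (2 : ℕ)) ≤ T → IsDyadicPointSet S T →
                (∀ t ∈ S, (q : ℝ) ^ (65 : ℕ) + q ≤ t) → (∀ t ∈ S, |t' t - t| ≤ 1) →
                defectE K ψ q S t' ≤
                  C * (T * Real.log q ^ (6 : ℕ) +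
                    T * Real.sqrt (calL χ T) * Real.log T ^ (2 : ℕ) * Real.log q ^ ((5 : ℝ) / 2)) :=
  prop91_floor_close_of_proposition64 proposition64_holds

/-- **CI PROPOSITION 9.1 (9.7) at the floor, ARBITRARY companions, UNCONDITIONAL**: `q^65 ≤ T`,
`e^{(log q)²} ≤ T`, points `t ≥ q^65 + 2q + 2` (`prop91_floor_of_proposition64` at
`proposition64_holds`). [cite: ConreyIwaniec2002, Proposition 9.1 (9.7)] -/
theorem prop91_floor :
    ∃ C : ℝ, 0 < C ∧
    ∀ (q : ℕ) [NeZero q], 4 < q → Odd q → ∀ χ : DirichletCharacter ℂ q,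
      χ.IsPrimitive → χ.IsQuadratic → χ.Odd →
        ∀ (K : Type) [Field K] [NumberField K],
          Module.finrank ℚ K = 2 → NumberField.discr K = -(q : ℤ) →
            ∀ (ψ : ClassGroup (𝓞 K) →* ℂˣ) (T : ℝ) (S : Finset ℝ) (t' : ℝ → ℝ),
              (q : ℝ) ^ (65 : ℕ) ≤ T → Real.exp (Real.log q ^ (2 : ℕ)) ≤ T → IsDyadicPointSet S T →
                (∀ t ∈ S, (q : ℝ) ^ (65 : ℕ) + 2 * q + 2 ≤ t) →
                defectE K ψ q S t' ≤
                  C * (T * Real.log q ^ (6 : ℕ) +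
                    T * Real.sqrt (calL χ T) * Real.log T ^ (2 : ℕ) * Real.log q ^ ((5 : ℝ) / 2)) :=
  prop91_floor_of_proposition64 proposition64_holds

/-- **CI PROPOSITION 9.1 (9.7), `2q^66 ≤ T`, `2e^{(log q)²} ≤ T`, ARBITRARY companions,
UNCONDITIONAL** (`prop91_unrestricted_of_proposition64` at `proposition64_holds`).
[cite: ConreyIwaniec2002, Proposition 9.1 (9.7)] -/
theorem prop91_unrestricted :
    ∃ C : ℝ, 0 < C ∧
    ∀ (q : ℕ) [NeZero q], 4 < q → Odd q → ∀ χ : DirichletCharacter ℂ q,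
      χ.IsPrimitive → χ.IsQuadratic → χ.Odd →
        ∀ (K : Type) [Field K] [NumberField K],
          Module.finrank ℚ K = 2 → NumberField.discr K = -(q : ℤ) →
            ∀ (ψ : ClassGroup (𝓞 K) →* ℂˣ) (T : ℝ) (S : Finset ℝ) (t' : ℝ → ℝ),
              2 * (q : ℝ) ^ (66 : ℕ) ≤ T → 2 * Real.exp (Real.log q ^ (2 : ℕ)) ≤ T →
                IsDyadicPointSet S T →
                defectE K ψ q S t' ≤
                  C * (T * Real.log q ^ (6 : ℕ) +
                    T * Real.sqrt (calL χ T) * Real.log T ^ (2 : ℕ) * Real.log q ^ ((5 : ℝ) / 2)) :=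
  prop91_unrestricted_of_proposition64 proposition64_holds

/-- **CI PROPOSITION 9.1 (9.7), `2q^66 ≤ T`, `2e^{(log q)²} ≤ T`, companions `|t′(t) − t| ≤ T/4`,
UNCONDITIONAL** (`prop91_far_of_proposition64` at `proposition64_holds`).
[cite: ConreyIwaniec2002, Proposition 9.1 (9.7)] -/
theorem prop91_far :
    ∃ C : ℝ, 0 < C ∧
    ∀ (q : ℕ) [NeZero q], 4 < q → Odd q → ∀ χ : DirichletCharacter ℂ q,
      χ.IsPrimitive → χ.IsQuadratic → χ.Odd →
        ∀ (K : Type) [Field K] [NumberField K],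
          Module.finrank ℚ K = 2 → NumberField.discr K = -(q : ℤ) →
            ∀ (ψ : ClassGroup (𝓞 K) →* ℂˣ) (T : ℝ) (S : Finset ℝ) (t' : ℝ → ℝ),
              2 * (q : ℝ) ^ (66 : ℕ) ≤ T → 2 * Real.exp (Real.log q ^ (2 : ℕ)) ≤ T →
                IsDyadicPointSet S T → (∀ t ∈ S, |t' t - t| ≤ T / 4) →
                defectE K ψ q S t' ≤
                  C * (T * Real.log q ^ (6 : ℕ) +
                    T * Real.sqrt (calL χ T) * Real.log T ^ (2 : ℕ) * Real.log q ^ ((5 : ℝ) / 2)) :=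
  prop91_far_of_proposition64 proposition64_holds

/-- **CI PROPOSITION 9.1 (9.7), `2q^68 ≤ T`, `2q²e^{(log q)²} ≤ T`, ARBITRARY companions,
UNCONDITIONAL** (`prop91_of_proposition64` at `proposition64_holds`).
[cite: ConreyIwaniec2002, Proposition 9.1 (9.7)] -/
theorem prop91_any :
    ∃ C : ℝ, 0 < C ∧
    ∀ (q : ℕ) [NeZero q], 4 < q → Odd q → ∀ χ : DirichletCharacter ℂ q,
      χ.IsPrimitive → χ.IsQuadratic → χ.Odd →
        ∀ (K : Type) [Field K] [NumberField K],
          Module.finrank ℚ K = 2 → NumberField.discr K = -(q : ℤ) →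
            ∀ (ψ : ClassGroup (𝓞 K) →* ℂˣ) (T : ℝ) (S : Finset ℝ) (t' : ℝ → ℝ),
              2 * (q : ℝ) ^ (68 : ℕ) ≤ T → 2 * (q : ℝ) ^ (2 : ℕ) * Real.exp (Real.log q ^ (2 : ℕ)) ≤ T →
                IsDyadicPointSet S T →
                defectE K ψ q S t' ≤
                  C * (T * Real.log q ^ (6 : ℕ) +
                    T * Real.sqrt (calL χ T) * Real.log T ^ (2 : ℕ) * Real.log q ^ ((5 : ℝ) / 2)) :=
  prop91_of_proposition64 proposition64_holds

/-- **CI PROPOSITION 8.1 (8.10), `2q^66 ≤ T`, `2e^{(log q)²} ≤ T`, ARBITRARY companions,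
UNCONDITIONAL** (`prop81_unrestricted_of_proposition64` at `proposition64_holds`).
[cite: ConreyIwaniec2002, Proposition 8.1 (8.10)] -/
theorem prop81_unrestricted :
    ∃ C : ℝ, 0 < C ∧
    ∀ (q : ℕ) [NeZero q], 4 < q → Odd q → ∀ χ : DirichletCharacter ℂ q,
      χ.IsPrimitive → χ.IsQuadratic → χ.Odd →
        ∀ (K : Type) [Field K] [NumberField K],
          Module.finrank ℚ K = 2 → NumberField.discr K = -(q : ℤ) →
            ∀ (ψ : ClassGroup (𝓞 K) →* ℂˣ) (T : ℝ) (S : Finset ℝ) (t' : ℝ → ℝ),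
              2 * (q : ℝ) ^ (66 : ℕ) ≤ T → 2 * Real.exp (Real.log q ^ (2 : ℕ)) ≤ T →
                IsDyadicPointSet S T →
                defectD K ψ q S t' ≤
                  C * (T * Real.log q ^ (7 : ℕ) + T * calL χ T * Real.log T ^ (4 : ℕ)) :=
  prop81_unrestricted_of_proposition64 proposition64_holds

/-- **CI PROPOSITION 8.1 (8.10) at the floor, close companions, UNCONDITIONAL**: `q^65 ≤ T`, points
`t ≥ q^65 + q`, `|t′(t) − t| ≤ 1` (`prop81_floor_close_of_proposition64` at `proposition64_holds`).
[cite: ConreyIwaniec2002, Proposition 8.1 (8.10)] -/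
theorem prop81_floor_close :
    ∃ C : ℝ, 0 < C ∧
    ∀ (q : ℕ) [NeZero q], 4 < q → Odd q → ∀ χ : DirichletCharacter ℂ q,
      χ.IsPrimitive → χ.IsQuadratic → χ.Odd →
        ∀ (K : Type) [Field K] [NumberField K],
          Module.finrank ℚ K = 2 → NumberField.discr K = -(q : ℤ) →
            ∀ (ψ : ClassGroup (𝓞 K) →* ℂˣ) (T : ℝ) (S : Finset ℝ) (t' : ℝ → ℝ),
              (q : ℝ) ^ (65 : ℕ) ≤ T → IsDyadicPointSet S T → (∀ t ∈ S, (q : ℝ) ^ (65 : ℕ) + q ≤ t) →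
                (∀ t ∈ S, |t' t - t| ≤ 1) →
                defectD K ψ q S t' ≤
                  C * (T * Real.log q ^ (7 : ℕ) + T * calL χ T * Real.log T ^ (4 : ℕ)) :=
  prop81_floor_close_of_proposition64 proposition64_holds

/-! ### The principal estimate (9.12) -/

/-- **CI PROPOSITION 9.2 (9.12) WITH `(log q)^{7/2}`, UNCONDITIONAL** (the cosmetic step (9.11) done
with the textbook `|L′(1,χ)| ≪ (log q)²`; `proposition92_weak_of_proposition64` at
`proposition64_holds`). [cite: ConreyIwaniec2002, Proposition 9.2 (9.12)] -/
theorem proposition92_weak :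
    ∃ C : ℝ, 0 < C ∧
    ∀ (q : ℕ) [NeZero q], 4 < q → Odd q → ∀ χ : DirichletCharacter ℂ q,
      χ.IsPrimitive → χ.IsQuadratic → χ.Odd →
        ∀ (K : Type) [Field K] [NumberField K],
          Module.finrank ℚ K = 2 → NumberField.discr K = -(q : ℤ) →
            ∀ (ψ : ClassGroup (𝓞 K) →* ℂˣ) (T : ℝ) (S : Finset ℝ) (t' : ℝ → ℝ),
              2 ≤ T → IsPointSet S T →
                ∑ t ∈ S, sincTerm t (t' t) ≤
                  C * (T / Real.log T * Real.log q ^ (6 : ℕ) +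
                    T * Real.log T * Real.sqrt ‖χ.LFunction 1‖ * Real.log q ^ ((7 : ℝ) / 2) +
                    Real.log q ^ ((5 : ℝ) / 2) / Real.log T *
                      Real.sqrt (T * ∑ t ∈ S, ‖dividedDifference (classGroupLFunction K ψ)
                        (1 / 2 + t * I) (1 / 2 + t' t * I)‖ ^ 2)) :=
  proposition92_weak_of_proposition64 proposition64_holds

/-- **The principal estimate (9.12) in exponent-`e` form, UNCONDITIONAL in Proposition 6.4**: given
a (9.11)-type input `h4` ("`(log T)L(1,χ)^{1/2}(log q)^e ≤ 1 ⇒ ℒ(T) ≪ L(1,χ)(log q)^{2e−5}`"), the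
middle term of (9.12) carries `(log q)^e` (`principalEstimate_of_proposition64` at
`proposition64_holds`; `e = 7/2` is fact-free, `e = 3` is the printed claim).
[cite: ConreyIwaniec2002, Proposition 9.2 (9.12), (9.11)] -/
theorem principalEstimate (e : ℝ)
    (h4 : ∃ C : ℝ, 0 < C ∧
      ∀ (q : ℕ) [NeZero q], 4 < q → ∀ χ : DirichletCharacter ℂ q,
        χ.IsPrimitive → χ.IsQuadratic → χ.Odd → ∀ T : ℝ, 2 ≤ T →
          Real.log T * Real.sqrt ‖χ.LFunction 1‖ * Real.log q ^ e ≤ 1 →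
            calL χ T ≤ C * (‖χ.LFunction 1‖ * Real.log q ^ (2 * e - 5))) :
    ∃ C : ℝ, 0 < C ∧
    ∀ (q : ℕ) [NeZero q], 4 < q → Odd q → ∀ χ : DirichletCharacter ℂ q,
      χ.IsPrimitive → χ.IsQuadratic → χ.Odd →
        ∀ (K : Type) [Field K] [NumberField K],
          Module.finrank ℚ K = 2 → NumberField.discr K = -(q : ℤ) →
            ∀ (ψ : ClassGroup (𝓞 K) →* ℂˣ) (T : ℝ) (S : Finset ℝ) (t' : ℝ → ℝ),
              2 ≤ T → IsPointSet S T →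
                ∑ t ∈ S, sincTerm t (t' t) ≤
                  C * (T / Real.log T * Real.log q ^ (6 : ℕ) +
                    T * Real.log T * Real.sqrt ‖χ.LFunction 1‖ * Real.log q ^ e +
                    Real.log q ^ ((5 : ℝ) / 2) / Real.log T *
                      Real.sqrt (T * ∑ t ∈ S, ‖dividedDifference (classGroupLFunction K ψ)
                        (1 / 2 + t * I) (1 / 2 + t' t * I)‖ ^ 2)) :=
  principalEstimate_of_proposition64 e proposition64_holds h4

/-- **CI PROPOSITION 9.2 AS TYPED (`conreyIwaniec2002_proposition92`) MODULO ONLY THE PRINTED (9.11)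
CLAIM `hLq`** ("if `(log T)L(1,χ)^{1/2}(log q)³ ≤ 1` then `ℒ(T) ≪ L(1,χ) log q`"; HONEST LABEL:
`|L′(1,χ)| ≪ log q` for real primitive `χ` in the exceptional regime — OPEN, NOT proved here;
Friedlander–Iwaniec 2018). Proposition 6.4 is no longer a hypothesis
(`proposition92_of_proposition64` at `proposition64_holds`).
[cite: ConreyIwaniec2002, Proposition 9.2 (9.12), (9.11)] -/
theorem proposition92_of_Lq
    (hLq : ∃ C : ℝ, 0 < C ∧
      ∀ (q : ℕ) [NeZero q], 4 < q → ∀ χ : DirichletCharacter ℂ q,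
        χ.IsPrimitive → χ.IsQuadratic → χ.Odd → ∀ T : ℝ, 2 ≤ T →
          Real.log T * Real.sqrt ‖χ.LFunction 1‖ * Real.log q ^ (3 : ℕ) ≤ 1 →
            calL χ T ≤ C * (‖χ.LFunction 1‖ * Real.log q)) :
    conreyIwaniec2002_proposition92 :=
  proposition92_of_proposition64 proposition64_holds hLq

/-! ### §10 / §1 consequences for odd `q`, unconditional in the Conrey–Iwaniec input -/

/-- **`L(1,χ) ≥ (log q)^{−67}` UNDER THE CLOSE-ZERO HYPOTHESIS OF THEOREM 1.1 (`A = 12`,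
`log T = (log q)^{18}`, `q` odd), UNCONDITIONAL in the CI input**
(`lOne_ge_log_pow_neg_67_of_proposition64` at `proposition64_holds`).
[cite: ConreyIwaniec2002, Theorem 1.1 (remark after (1.21))] -/
theorem lOne_ge_log_pow_neg_67 :
    ∃ c : ℝ, 0 < c ∧
      ∀ (q : ℕ) [NeZero q], 4 < q → Odd q → ∀ χ : DirichletCharacter ℂ q,
        χ.IsPrimitive → χ.IsQuadratic → χ.Odd →
          ∀ (K : Type) [Field K] [NumberField K],
            Module.finrank ℚ K = 2 → NumberField.discr K = -(q : ℤ) →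
              ∀ (ψ : ClassGroup (𝓞 K) →* ℂˣ) (T α : ℝ), 2 ≤ T → 0 < α → α ≤ 1 →
                Real.log T = Real.log q ^ (18 : ℝ) →
                  α⁻¹ * c * T * Real.log T ^ ((1 : ℝ) / 3) ≤
                      (closeZeroCount (classGroupLFunction K ψ) α T : ℝ) →
                    Real.log q ^ (-(67 : ℝ)) ≤ ‖χ.LFunction 1‖ :=
  lOne_ge_log_pow_neg_67_of_proposition64 proposition64_holds

/-- **CI COROLLARY 1.3 FOR ODD `q` (weak form, `c′(log q)^{−19}`), UNCONDITIONAL in the CI input**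
(`corollary13_odd_weak_of_proposition64` at `proposition64_holds`).
[cite: ConreyIwaniec2002, Corollary 1.3] -/
theorem corollary13_odd_weak :
    ∃ c₁ : ℝ, 0 < c₁ ∧ ∃ c' : ℝ, 0 < c' ∧
      ∀ (q : ℕ) [NeZero q], 4 < q → Odd q → ∀ χ : DirichletCharacter ℂ q,
        χ.IsPrimitive → χ.IsQuadratic → χ.Odd →
          ∀ (K : Type) [Field K] [NumberField K],
            Module.finrank ℚ K = 2 → NumberField.discr K = -(q : ℤ) →
              ∀ (ψ : ClassGroup (𝓞 K) →* ℂˣ) (S : Finset ℝ),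
                IsPointSet S (Real.exp (Real.log q ^ (6 : ℕ))) →
                  (∀ t ∈ S, ‖deriv (classGroupLFunction K ψ) (1 / 2 + t * I)‖ ≤
                      Real.log q ^ ((7 : ℝ) / 2)) →
                    c₁ * Real.exp (Real.log q ^ (6 : ℕ)) ≤ (S.card : ℝ) →
                      c' * Real.log q ^ (-(19 : ℝ)) ≤ ‖χ.LFunction 1‖ :=
  corollary13_odd_weak_of_proposition64 proposition64_holds

/-- **THE DEDEKIND-CLOSE-ZERO DOOR WITH `H_K(A, α)` AS ITS ONLY HYPOTHESIS**: the mixed-pairs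
requirement `DedekindCloseZeroHypothesis A α` gives `L(1,χ) ≥ ¼ (log q)^{−(4A+19)}` for all large odd
`q` — the Conrey–Iwaniec input (Proposition 6.4) is discharged
(`lOne_lowerBound_of_dedekindCloseZero_of_proposition64` at `proposition64_holds`; compare the tree's
`lOne_lowerBound_of_dedekindCloseZero`, exponent `4A+18` modulo the printed Theorem 1.1).
[cite: ConreyIwaniec2002, Theorem 1.1 (1.21)] -/
theorem lOne_lowerBound_of_dedekindCloseZero_weak {A α : ℝ} (hA : 0 ≤ A) (hα : 0 < α)
    (hα1 : α ≤ 1) (h : DedekindCloseZeroHypothesis A α) :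
    ∃ q₀ : ℕ, ∀ (q : ℕ) [NeZero q], q₀ ≤ q → 4 < q → Odd q →
      ∀ χ : DirichletCharacter ℂ q, χ.IsPrimitive → χ.IsQuadratic → χ.Odd →
        ∀ (K : Type) [Field K] [NumberField K],
          Module.finrank ℚ K = 2 → NumberField.discr K = -(q : ℤ) →
            (1 / 4) * Real.log q ^ (-(4 * A + 19)) ≤ ‖χ.LFunction 1‖ :=
  lOne_lowerBound_of_dedekindCloseZero_of_proposition64 hA hα hα1 proposition64_holds h

end ConreyIwaniec2002

end Literature.NumberTheory.LFunctions

end
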